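import Summits.HodgeConjecture.HodgeConjecture.Theorems.HeckePrymWeilHeckePrymAnchorsOfSections
import Summits.HodgeConjecture.HodgeConjecture.Theorems.HeckePrymWeilHeckePrymAnchorsGlobalClassOfLeray
import Literature.AlgebraicGeometry.HodgeTheory.InvariantClassesFromTotalSpaceProofs
import Literature.AlgebraicGeometry.HodgeTheory.WeilFamilyFlatSections
import HarnessLib

/-!
# `HeckePrymAnchors` modulo its two CORE named facts: Voisin II Thm. 4.18 (`ℚ`-form) and Deligne's Weil family (item stmt-HodgeConjecture-14496, route HeckePrymWeil)

Line `Sketch`, v10 (continuation lead c6): the crux `HeckePrymAnchors` of route `HeckePrymWeil`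
derived from EXACTLY the two named facts registered as the stubs of the line's skeleton
(`Cruxes/HeckePrymAnchors/Lines/Sketch.lean`: `stub_fact_voisin`, `stub_weilFamilyHodge`), both taken
as hypotheses (the result is CONDITIONAL on them and on nothing else):

* `hV : Motives.Voisin2003_invariantCycles` (`Motives/FlatSubfamily`) — Deligne 1968, Prop. (2.1) with
  (2.6.3) = Voisin, *Hodge Theory II*, Thm. 4.18 (with Def. 4.14, Thm. 4.15, Lemma 4.17), in its
  printed `ℚ`-form on tubes: for `f : 𝒳 ⟶ U` smooth and projective over a smooth quasi-compact
  separated `U`, every flat section of `Rⁿ f(ℂ)_* ℚ` is the family of restrictions of one class of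
  `Hⁿ(𝒳(ℂ); ℚ)`. The accepted two-fact closure `heckePrymAnchors_of_two_facts` (p107536,
  `…HeckePrymAnchorsOfTwoFacts`) took instead the `ℂ`-carrier rendering
  `HodgeTheory.deligne1968_invariantClass_fromTotalSpace`; the tree has since PROVED that rendering from
  the `ℚ`-form (`HodgeTheory.deligne1968_invariantClass_fromTotalSpace_of_invariantCycles`,
  `HodgeTheory/InvariantClassesFromTotalSpaceProofs`: `Rᵏ f_* ℂ` is a local system, coordinates in a
  `ℚ`-basis of `ℂ` are flat `ℚ`-sections, universal coefficients on the compact fibre), so the debt is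
  the `ℚ`-core itself;
* `hWF : HodgeTheory.deligne1982_weilFamily_hodgeWeilSection` (`HodgeTheory/WeilFamilyFlatSections`) —
  Deligne, LNM 900 I, proof of Thm. 4.8 (pp. 47–52) with clause (a) and Prop. 4.4; van Geemen LNM 1594
  §5.3–5.11; André 1996 Lemme 6.3.3: the polarized `ℚ(√-p)`-Weil family through `X` with a flat Weil
  section through `c`, of Hodge type `(k,k)` at every fibre, and a tensor-split fibre.

Everything else is PROVED in the tree and reused: `heckePrymAnchors_of_sections` (composition, p101202),
`stub_globalClassOfSection_of_leray` (W-engine, p101992), and through them `stub_weilSurface`,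
`stub_upgrade`, `stub_rationalAlongSection`, `owf_anchored_zero`, `owf_anchorAlgebraic` (Deligne's
tensor-point anchor), `owf_isoTransport`. This is the term of `HeckePrymAnchors_of` in the registered
skeleton with the two `sorry`d stubs replaced by hypotheses; its statement is the stub
`heckePrymAnchors_of_voisin2003_of_weilFamily` registered on the item by lead c4 (v8). No definition, no `sorry`.
-/

noncomputable section

-- every declaration of this problem lives in `Summit.HodgeConjecture.HodgeConjecture.…` (summit = sub-problem)
set_option linter.dupNamespace false

open CategoryTheory AlgebraicGeometry Limits MonoidalCategory CartesianMonoidalCategory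

namespace Summit.HodgeConjecture.HodgeConjecture.Theorems.HeckePrymWeilLine

open Literature.AlgebraicGeometry Literature.AlgebraicGeometry.Motives Literature.AlgebraicGeometry.HodgeTheory
open Summit.HodgeConjecture.HodgeConjecture.Theses.HeckePrymWeil

/-- **`HeckePrymAnchors` from its two core named facts** (CONDITIONAL result): the `ℚ`-form of
Voisin II Thm. 4.18 `Motives.Voisin2003_invariantCycles` and Deligne's Weil family with a flat,
fibrewise Hodge, Weil section and a tensor-split fibre `deligne1982_weilFamily_hodgeWeilSection`
together imply the crux. Proof: upgrade `hV` to the `ℂ`-carrier statement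
`deligne1968_invariantClass_fromTotalSpace` by the tree's proved reduction
`deligne1968_invariantClass_fromTotalSpace_of_invariantCycles`, feed it to the landed W-engine
`stub_globalClassOfSection_of_leray`, and compose with `hWF` by the landed
`heckePrymAnchors_of_sections` — for the rational `(k,k)` class `c ≠ 0` of the typed Weil plane of
`(A × B, φ × ψ)`, `B = E × E` the companion surface, take the Weil family through `A × B` with its
flat section through `c`, globalise it to one class `W` of the open total space, read rationality and
Hodge type `(k,k)` of `W|_{𝒳_s}` along the section, and algebraicity at the tensor-split fibre from
Deligne's tensor-point anchor; `c = 0` is anchored by the constant family.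
[cite: Deligne1968, Prop. (2.1) with (2.6.3)] [cite: VoisinHodgeII2003, Thm. 4.18]
[cite: Deligne1982HodgeCycles, proof of Thm. 4.8 (pp. 47–52) with (a), Prop. 4.4, Lemma 4.5, Remark 4.10]
[cite: vanGeemen1994HodgeAV, §5.3–5.11] [cite: Andre1996Motifs, Lemme 6.3.3] -/
theorem heckePrymAnchors_of_voisin2003_of_weilFamily :
    (Voisin2003_invariantCycles) → (deligne1982_weilFamily_hodgeWeilSection) → Summit.HodgeConjecture.HodgeConjecture.Theses.HeckePrymWeil.HeckePrymAnchors :=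
  fun hV hWF =>
    heckePrymAnchors_of_sections
      (stub_globalClassOfSection_of_leray
        (deligne1968_invariantClass_fromTotalSpace_of_invariantCycles hV))
      hWF

end Summit.HodgeConjecture.HodgeConjecture.Theorems.HeckePrymWeilLine

end
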